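import Summits.QuantumFields.YangMills.Theorems.BalabanUVNodesN15KingModelBoxSumRulesResolvent
import Summits.QuantumFields.YangMills.Theorems.BalabanUVNodesN15KingModelBoxFreeEnergyComparison
import Mathlib.Analysis.Convex.Deriv
import HarnessLib

/-!
# BalabanUVNodes ∕ N15 — THE KING-MODEL RUNG (PART Ϟ-u): THE FREE ENERGY DENSITY IS STRICTLY CONCAVE IN `m²` — ON EVERY BOX WITH FREE BOUNDARY CONDITIONS
# (`∂²_{m²}(|Ω|⁻¹ln det(c(−Δ_free)+m²)_Ω) = −|Ω|⁻¹Σ_sΣ_uG^Ω(s,u)² < 0`) AND IN INFINITE VOLUME (`∂_{m²}K_∞(0) = −(2π)^{−(d+1)}∫_{zone}(m²+cΣ(2−2cos p))⁻²dp < 0`, so `∂²_{m²}f_∞ < 0`)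
# (Track A, DAG node N15 = NE2; FAN-OUT v1.1 §N15 s3 «KING-MODEL RUNG»; King (3.89) p.668, (4.4) p.670, §4 p.670 l.8–13; count-neutral)

HONEST FRAMING.  Count-neutral (cell `pub-ymgap`, seat `pub-ymgap-dag-n15-e` g41; K3ᴬ key **stmt-QuantumFields-27247** `--supports … --as helper` per KEY MAP v3).  TEMPLATE LITERATURE:
C. King, Commun. Math. Phys. **102** (1986) 649–677 [King1986]: (2.17) p.653, (3.89) p.668 (`ln 𝒩 = −½ln det + …`), (4.4) p.670 (the symbol), §4 p.670 l.8–13 (King's region `Ω`);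
T. Bałaban, Commun. Math. Phys. **89** (1983) 571–597 [Balaban1983RegularityDecay]: (2.43) p.584 (`K_∞`).  Part Ϟ-m: Jacobi on `Ω` (`hasDerivAt_log_det_boxOp_div_card`: the derivative is the
averaged Green diagonal); part Ϟ-s: `∂_{m²}G^Ω(s,s) = −Σ_uG^Ω(s,u)²`; part Ε-y: `∂_{m²}f_∞ = K_∞(0) = (2π)^{−(d+1)}∫_{zone}(m²+cΣ(2−2cos p))⁻¹dp` by differentiation under the integral; part Ϟ-t:
the torus case.  THIS FILE: §1 BOX ★★ **`hasDerivAt_avg_kingBoxGreen_diag`** (`∂_{m²}|Ω|⁻¹Σ_sG^Ω(s,s) = −|Ω|⁻¹Σ_sΣ_uG^Ω(s,u)²`), ★★ `hasDerivAt_deriv_log_det_boxOp_div_card`, `kingBoxGreen_diag_pos`, `sum_sum_kingBoxGreen_sq_pos`,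
★★★ **`strictConcaveOn_log_det_boxOp_div_card`** (`m² ↦ |Ω|⁻¹ln det(c(−Δ_free)+m²)_Ω` is STRICTLY CONCAVE on `(0,∞)`, every box, `c ≥ 0`); §2 INFINITE VOLUME ★★
**`hasDerivAt_integral_inv_kingSym`** (second differentiation under the integral sign: `∂_{m²}∫1_{zone}(m²+cS)⁻¹ = −∫1_{zone}(m²+cS)⁻²`, dominated by `4∕m⁴` near `m²`), ★★★
**`hasDerivAt_freeKer_zero`** (`∂_{m²}K_∞(0) = −(2π)^{−(d+1)}∫_{zone}(m²+cS)⁻²`), ★★ `hasDerivAt_deriv_kingFreeEnergyInf`, `volume_zone_toReal` (`= (2π)^{d+1}`), ★ `integral_inv_kingSym_sq_pos`,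
★★★ **`strictConcaveOn_kingFreeEnergyInf`** (`m² ↦ f_∞(c,m²)` is STRICTLY CONCAVE on `(0,∞)`).

PRIOR TREE ART (named, USED not restated): Ϟ-m (`hasDerivAt_log_det_boxOp_div_card`), Ϟ-s (`hasDerivAt_kingBoxGreen_diag`), Ε-y (`hasDerivAt_kingFreeEnergyInf_eq_freeKer_zero`,
`freeKer_zero_eq_integral`, `volume_box_lt_top`, `differentiableAt_kingFreeEnergyInf`), Ε-e (`inv_le_lapF_inv_diag`) with Ϟ-o (`lapF_dbl_inv_diag_le_kingBoxGreen_diag`) — together they give the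
positivity `G^Ω(s,s) > 0` (`kingBoxGreen_diag_pos`), Mathlib (`hasDerivAt_integral_of_dominated_loc_of_deriv_le`, `strictConcaveOn_of_deriv2_neg'`).  (v1.1: header roster corrected per
ref-I READ-970 NIT 1; declarations byte-identical.)  NOT Bałaban's covariant objects; NOT a node
discharge (N15 is booked through n15-a's knit, untouched); nothing continuum-YM ∕ `ℝ⁴` ∕ OS ∕ Clay.  0 `sorry`; 0 `def`.

HONEST SCOPE.  King's `A = 0` free symbol ∕ operators, `c ≥ 0`, `m² ∈ (0,∞)`; one-variable calculus in `m²`.  Locators: [King1986] (2.17) p.653, (3.89) p.668, (4.4) p.670, §4 p.670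
l.8–13; [Balaban1983RegularityDecay] (2.43) p.584.
-/

noncomputable section

open scoped BigOperators Topology
open Finset Filter MeasureTheory

namespace Summit.QuantumFields.YangMills.BalabanUVNodes.N15KingModelRung.TorusSpectral

variable {d : ℕ}

/-! ## §1 Strict concavity on every box with free boundary conditions -/

section Box

variable (n : Fin (d + 1) → ℕ) [hn : ∀ μ, NeZero (n μ)] {c : ℝ}

/-- ★★ **`∂_{m²}(|Ω|⁻¹Σ_sG^Ω(s,s)) = −|Ω|⁻¹Σ_sΣ_uG^Ω(s,u)²`** (part Ϟ-s's diagonal derivative, summed). [cite: King1986, (2.17) p.653, §4 p.670 l.8–13] -/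
theorem hasDerivAt_avg_kingBoxGreen_diag (hc : 0 ≤ c) {m2 : ℝ} (hm : 0 < m2) :
    HasDerivAt (fun m : ℝ => (Fintype.card (KingBox n) : ℝ)⁻¹ * ∑ s : KingBox n, kingBoxGreen n c m s s)
      (-((Fintype.card (KingBox n) : ℝ)⁻¹ * ∑ s : KingBox n, ∑ u, kingBoxGreen n c m2 s u ^ 2)) m2 := by
  have h := (HasDerivAt.fun_sum (u := Finset.univ) fun s _ => hasDerivAt_kingBoxGreen_diag n hc hm s).const_mul ((Fintype.card (KingBox n) : ℝ)⁻¹)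
  rw [Finset.sum_neg_distrib, mul_neg] at h
  exact h

/-- ★★ **THE SECOND MASS DERIVATIVE OF THE FREE-BOUNDARY FREE ENERGY DENSITY**: `∂²_{m²}(|Ω|⁻¹ln det(c(−Δ_free)+m²)_Ω) = −|Ω|⁻¹Σ_sΣ_uG^Ω(s,u)²`.
[cite: King1986, (3.89) p.668, (2.17) p.653, §4 p.670 l.8–13] -/
theorem hasDerivAt_deriv_log_det_boxOp_div_card (hc : 0 ≤ c) {m2 : ℝ} (hm : 0 < m2) :
    HasDerivAt (deriv fun m : ℝ => (Fintype.card (KingBox n) : ℝ)⁻¹ * Real.log (boxOp n c m).det)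
      (-((Fintype.card (KingBox n) : ℝ)⁻¹ * ∑ s : KingBox n, ∑ u, kingBoxGreen n c m2 s u ^ 2)) m2 := by
  refine (hasDerivAt_avg_kingBoxGreen_diag n hc hm).congr_of_eventuallyEq ?_
  filter_upwards [Ioi_mem_nhds hm] with m hm'
  exact (hasDerivAt_log_det_boxOp_div_card n hc hm').deriv

/-- `G^Ω(s,s) > 0` (the direct image alone is `≥ 1∕(m²+4c(d+1))`, parts Ϟ-o∕Ε-e). [cite: King1986, (2.17) p.653, §4 p.670 l.8–13] -/
theorem kingBoxGreen_diag_pos (hc : 0 ≤ c) {m2 : ℝ} (hm : 0 < m2) (s : KingBox n) : 0 < kingBoxGreen n c m2 s s :=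
  lt_of_lt_of_le (lt_of_lt_of_le (by positivity) (inv_le_lapF_inv_diag (dblPer n) hc hm 0)) (lapF_dbl_inv_diag_le_kingBoxGreen_diag n hc hm s)

/-- `Σ_sΣ_uG^Ω(s,u)² > 0`. [cite: King1986, (2.17) p.653, §4 p.670 l.8–13] -/
theorem sum_sum_kingBoxGreen_sq_pos (hc : 0 ≤ c) {m2 : ℝ} (hm : 0 < m2) : 0 < ∑ s : KingBox n, ∑ u, kingBoxGreen n c m2 s u ^ 2 := by
  have h1 : ∀ s : KingBox n, 0 < ∑ u, kingBoxGreen n c m2 s u ^ 2 := fun s =>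
    lt_of_lt_of_le (pow_pos (kingBoxGreen_diag_pos n hc hm s) 2) (Finset.single_le_sum (fun u _ => sq_nonneg (kingBoxGreen n c m2 s u)) (Finset.mem_univ s))
  exact Finset.sum_pos (fun s _ => h1 s) ⟨0, Finset.mem_univ _⟩

/-- ★★★ **THE FREE-BOUNDARY FREE ENERGY DENSITY IS STRICTLY CONCAVE IN `m² ∈ (0,∞)`** on every box (`c ≥ 0`). [cite: King1986, (3.89) p.668, (4.4) p.670, §4 p.670 l.8–13] -/
theorem strictConcaveOn_log_det_boxOp_div_card (hc : 0 ≤ c) :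
    StrictConcaveOn ℝ (Set.Ioi 0) (fun m : ℝ => (Fintype.card (KingBox n) : ℝ)⁻¹ * Real.log (boxOp n c m).det) := by
  refine strictConcaveOn_of_deriv2_neg' (convex_Ioi 0) (fun m hm => (hasDerivAt_log_det_boxOp_div_card n hc hm).continuousAt.continuousWithinAt) fun m hm => ?_
  have hm' : 0 < m := hm
  have hcard : (0 : ℝ) < Fintype.card (KingBox n) := by exact_mod_cast Fintype.card_pos
  rw [Function.iterate_succ_apply, Function.iterate_one, (hasDerivAt_deriv_log_det_boxOp_div_card n hc hm').deriv, neg_lt_zero]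
  exact mul_pos (inv_pos.mpr hcard) (sum_sum_kingBoxGreen_sq_pos n hc hm')

end Box

/-! ## §2 Strict concavity in infinite volume -/

section Infinite

variable {c : ℝ}

/-- ★★ **SECOND DIFFERENTIATION UNDER THE INTEGRAL SIGN**: `∂_{m²}∫1_{zone}(m²+cΣ(2−2cos p_μ))⁻¹dp = −∫1_{zone}(m²+cΣ(2−2cos p_μ))⁻²dp` (`c ≥ 0`, `m² > 0`; dominated by `4∕m⁴` on
`(m²∕2, 3m²∕2)`). [cite: King1986, (4.4) p.670; Balaban1983RegularityDecay, (2.43) p.584] -/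
theorem hasDerivAt_integral_inv_kingSym (hc : 0 ≤ c) {m2 : ℝ} (hm : 0 < m2) :
    HasDerivAt (fun m : ℝ => ∫ p : Fin (d + 1) → ℝ, (Set.pi Set.univ fun _ : Fin (d + 1) => Set.Ioc (-Real.pi) Real.pi).indicator (fun p => (m + c * ∑ μ, (2 - 2 * Real.cos (p μ)))⁻¹) p)
      (∫ p : Fin (d + 1) → ℝ, -(Set.pi Set.univ fun _ : Fin (d + 1) => Set.Ioc (-Real.pi) Real.pi).indicator (fun p => ((m2 + c * ∑ μ, (2 - 2 * Real.cos (p μ))) ^ 2)⁻¹) p) m2 := by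
  set box : Set (Fin (d + 1) → ℝ) := Set.pi Set.univ fun _ : Fin (d + 1) => Set.Ioc (-Real.pi) Real.pi with hbox
  have hboxm : MeasurableSet box := MeasurableSet.univ_pi fun _ => measurableSet_Ioc
  have hvol : volume box < ⊤ := volume_box_lt_top
  have hA : ∀ p : Fin (d + 1) → ℝ, 0 ≤ c * ∑ μ, (2 - 2 * Real.cos (p μ)) := fun p =>
    mul_nonneg hc (Finset.sum_nonneg fun μ _ => by linarith [Real.cos_le_one (p μ)])
  have hAmeas : Measurable fun p : Fin (d + 1) → ℝ => c * ∑ μ, (2 - 2 * Real.cos (p μ)) := by fun_prop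
  have hs : Set.Ioo (m2 / 2) (3 * m2 / 2) ∈ 𝓝 m2 := Ioo_mem_nhds (by linarith) (by linarith)
  refine (hasDerivAt_integral_of_dominated_loc_of_deriv_le (μ := volume) (F := fun m p => box.indicator (fun p => (m + c * ∑ μ, (2 - 2 * Real.cos (p μ)))⁻¹) p)
    (F' := fun m p => -box.indicator (fun p => ((m + c * ∑ μ, (2 - 2 * Real.cos (p μ))) ^ 2)⁻¹) p)
    (bound := box.indicator fun _ => (2 / m2) ^ 2) hs ?_ ?_ ?_ ?_ ?_ ?_).2
  · refine Eventually.of_forall fun m => ?_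
    exact ((measurable_const.add hAmeas).inv.aestronglyMeasurable).indicator hboxm
  · refine Integrable.mono' ((integrableOn_const (C := m2⁻¹) hvol.ne).integrable_indicator hboxm) ?_ ?_
    · exact ((measurable_const.add hAmeas).inv.aestronglyMeasurable).indicator hboxm
    · refine Eventually.of_forall fun p => ?_
      by_cases hp : p ∈ box
      · rw [Set.indicator_of_mem hp, Set.indicator_of_mem hp, Real.norm_eq_abs]
        have hpos : 0 < m2 + c * ∑ μ, (2 - 2 * Real.cos (p μ)) := by have := hA p; linarith
        rw [abs_of_pos (inv_pos.mpr hpos)]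
        exact inv_anti₀ hm (by linarith [hA p])
      · rw [Set.indicator_of_notMem hp, Set.indicator_of_notMem hp, norm_zero]
  · exact (((measurable_const.add hAmeas).pow_const 2).inv.aestronglyMeasurable.indicator hboxm).neg
  · refine Eventually.of_forall fun p m hmI => ?_
    by_cases hp : p ∈ box
    · rw [Set.indicator_of_mem hp, Set.indicator_of_mem hp, norm_neg, Real.norm_eq_abs]
      have hm' : m2 / 2 < m := hmI.1
      have hpos : 0 < m + c * ∑ μ, (2 - 2 * Real.cos (p μ)) := by have := hA p; linarith
      rw [abs_of_pos (by positivity)]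
      have hle : m2 / 2 ≤ m + c * ∑ μ, (2 - 2 * Real.cos (p μ)) := by have := hA p; linarith
      have h2 : (m2 / 2) ^ 2 ≤ (m + c * ∑ μ, (2 - 2 * Real.cos (p μ))) ^ 2 := pow_le_pow_left₀ (by positivity) hle 2
      calc ((m + c * ∑ μ, (2 - 2 * Real.cos (p μ))) ^ 2)⁻¹ ≤ ((m2 / 2) ^ 2)⁻¹ := inv_anti₀ (by positivity) h2
        _ = (2 / m2) ^ 2 := by rw [div_pow, div_pow, inv_div]
    · rw [Set.indicator_of_notMem hp, Set.indicator_of_notMem hp, neg_zero, norm_zero]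
  · exact (integrableOn_const (C := (2 / m2) ^ 2) hvol.ne).integrable_indicator hboxm
  · refine Eventually.of_forall fun p m hmI => ?_
    by_cases hp : p ∈ box
    · simp only [Set.indicator_of_mem hp]
      have hm' : m2 / 2 < m := hmI.1
      have hpos : 0 < m + c * ∑ μ, (2 - 2 * Real.cos (p μ)) := by have := hA p; linarith
      have h := ((hasDerivAt_id m).add_const (c * ∑ μ, (2 - 2 * Real.cos (p μ)))).inv hpos.ne'
      simp only [id] at h
      rw [neg_div, one_div] at h
      exact h
    · simp only [Set.indicator_of_notMem hp, neg_zero]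
      exact hasDerivAt_const m 0

/-- ★★★ **THE MASS DERIVATIVE OF `K_∞(0)`**: `∂_{m²}K_∞(0) = −(2π)^{−(d+1)}∫_{zone}(m²+cΣ(2−2cos p_μ))⁻²dp` (`c ≥ 0`, `m² > 0`). [cite: Balaban1983RegularityDecay, (2.43) p.584; King1986, (4.4) p.670] -/
theorem hasDerivAt_freeKer_zero (hc : 0 ≤ c) {m2 : ℝ} (hm : 0 < m2) :
    HasDerivAt (fun m : ℝ => freeKer c m (0 : Fin (d + 1) → ℤ))
      (-(((2 * Real.pi) ^ (d + 1))⁻¹ * ∫ p : Fin (d + 1) → ℝ,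
          (Set.pi Set.univ fun _ : Fin (d + 1) => Set.Ioc (-Real.pi) Real.pi).indicator (fun p => ((m2 + c * ∑ μ, (2 - 2 * Real.cos (p μ))) ^ 2)⁻¹) p)) m2 := by
  have hfun : (fun m : ℝ => freeKer c m (0 : Fin (d + 1) → ℤ)) = fun m => ((2 * Real.pi) ^ (d + 1))⁻¹ * ∫ p : Fin (d + 1) → ℝ,
      (Set.pi Set.univ fun _ : Fin (d + 1) => Set.Ioc (-Real.pi) Real.pi).indicator (fun p => (m + c * ∑ μ, (2 - 2 * Real.cos (p μ)))⁻¹) p :=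
    funext fun m => freeKer_zero_eq_integral c m
  rw [hfun]
  have h := (hasDerivAt_integral_inv_kingSym (d := d) hc hm).const_mul (((2 * Real.pi) ^ (d + 1))⁻¹)
  rw [integral_neg, mul_neg] at h
  exact h

/-- ★★ **THE SECOND MASS DERIVATIVE OF `f_∞`**: `∂²_{m²}f_∞ = ∂_{m²}K_∞(0) = −(2π)^{−(d+1)}∫_{zone}(m²+cS)⁻²`. [cite: King1986, (3.89) p.668, (4.4) p.670] -/
theorem hasDerivAt_deriv_kingFreeEnergyInf (hc : 0 ≤ c) {m2 : ℝ} (hm : 0 < m2) :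
    HasDerivAt (deriv fun m : ℝ => kingFreeEnergyInf c m d)
      (-(((2 * Real.pi) ^ (d + 1))⁻¹ * ∫ p : Fin (d + 1) → ℝ,
          (Set.pi Set.univ fun _ : Fin (d + 1) => Set.Ioc (-Real.pi) Real.pi).indicator (fun p => ((m2 + c * ∑ μ, (2 - 2 * Real.cos (p μ))) ^ 2)⁻¹) p)) m2 := by
  refine (hasDerivAt_freeKer_zero hc hm).congr_of_eventuallyEq ?_
  filter_upwards [Ioi_mem_nhds hm] with m hm'
  exact (hasDerivAt_kingFreeEnergyInf_eq_freeKer_zero (d := d) hc hm').deriv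

/-- the zone has Lebesgue measure `(2π)^{d+1}`. [folklore] -/
theorem volume_zone_toReal : (volume (Set.pi Set.univ fun _ : Fin (d + 1) => Set.Ioc (-Real.pi) Real.pi)).toReal = (2 * Real.pi) ^ (d + 1) := by
  rw [volume_pi_pi]
  simp only [Real.volume_Ioc, sub_neg_eq_add, Finset.prod_const, Finset.card_univ, Fintype.card_fin, ENNReal.toReal_pow]
  rw [ENNReal.toReal_ofReal (by positivity)]
  ring

/-- ★ `∫_{zone}(m²+cΣ(2−2cos p_μ))⁻²dp ≥ (2π)^{d+1}∕(m²+4c(d+1))² > 0`. [cite: King1986, (4.4) p.670] -/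
theorem integral_inv_kingSym_sq_pos (hc : 0 ≤ c) {m2 : ℝ} (hm : 0 < m2) :
    0 < ∫ p : Fin (d + 1) → ℝ, (Set.pi Set.univ fun _ : Fin (d + 1) => Set.Ioc (-Real.pi) Real.pi).indicator (fun p => ((m2 + c * ∑ μ, (2 - 2 * Real.cos (p μ))) ^ 2)⁻¹) p := by
  set box : Set (Fin (d + 1) → ℝ) := Set.pi Set.univ fun _ : Fin (d + 1) => Set.Ioc (-Real.pi) Real.pi with hbox
  have hboxm : MeasurableSet box := MeasurableSet.univ_pi fun _ => measurableSet_Ioc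
  have hvol : volume box < ⊤ := volume_box_lt_top
  have hA : ∀ p : Fin (d + 1) → ℝ, 0 ≤ c * ∑ μ, (2 - 2 * Real.cos (p μ)) ∧ c * ∑ μ, (2 - 2 * Real.cos (p μ)) ≤ 4 * c * (d + 1) := fun p => by
    refine ⟨mul_nonneg hc (Finset.sum_nonneg fun μ _ => by linarith [Real.cos_le_one (p μ)]), ?_⟩
    have h4 : ∑ μ, (2 - 2 * Real.cos (p μ)) ≤ ∑ _μ : Fin (d + 1), (4 : ℝ) := Finset.sum_le_sum fun μ _ => by linarith [Real.neg_one_le_cos (p μ)]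
    rw [Finset.sum_const, Finset.card_univ, Fintype.card_fin, nsmul_eq_mul] at h4
    push_cast at h4
    nlinarith
  have hAmeas : Measurable fun p : Fin (d + 1) → ℝ => c * ∑ μ, (2 - 2 * Real.cos (p μ)) := by fun_prop
  have hκ : 0 < ((m2 + 4 * c * (d + 1)) ^ 2)⁻¹ := by positivity
  have hint : Integrable (fun p => box.indicator (fun p => ((m2 + c * ∑ μ, (2 - 2 * Real.cos (p μ))) ^ 2)⁻¹) p) := by
    refine Integrable.mono' ((integrableOn_const (C := (m2 ^ 2)⁻¹) hvol.ne).integrable_indicator hboxm) ?_ ?_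
    · exact (((measurable_const.add hAmeas).pow_const 2).inv.aestronglyMeasurable).indicator hboxm
    · refine Eventually.of_forall fun p => ?_
      by_cases hp : p ∈ box
      · rw [Set.indicator_of_mem hp, Set.indicator_of_mem hp, Real.norm_eq_abs, abs_of_pos (by have := (hA p).1; positivity)]
        exact inv_anti₀ (by positivity) (pow_le_pow_left₀ hm.le (by linarith [(hA p).1]) 2)
      · rw [Set.indicator_of_notMem hp, Set.indicator_of_notMem hp, norm_zero]
  have hle : ∫ p : Fin (d + 1) → ℝ, box.indicator (fun _ => ((m2 + 4 * c * (d + 1)) ^ 2)⁻¹) p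
      ≤ ∫ p : Fin (d + 1) → ℝ, box.indicator (fun p => ((m2 + c * ∑ μ, (2 - 2 * Real.cos (p μ))) ^ 2)⁻¹) p := by
    refine integral_mono ((integrableOn_const (C := ((m2 + 4 * c * (d + 1)) ^ 2)⁻¹) hvol.ne).integrable_indicator hboxm) hint fun p => ?_
    by_cases hp : p ∈ box
    · simp only [Set.indicator_of_mem hp]
      have h0 : 0 < m2 + c * ∑ μ, (2 - 2 * Real.cos (p μ)) := by have := (hA p).1; linarith
      exact inv_anti₀ (by positivity) (pow_le_pow_left₀ h0.le (by linarith [(hA p).2]) 2)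
    · simp only [Set.indicator_of_notMem hp, le_refl]
  rw [integral_indicator_const _ hboxm, measureReal_def, volume_zone_toReal, smul_eq_mul] at hle
  exact lt_of_lt_of_le (by positivity) hle

/-- ★★★ **THE INFINITE-VOLUME FREE ENERGY DENSITY `f_∞(c,·)` IS STRICTLY CONCAVE ON `(0,∞)`** (`c ≥ 0`). [cite: King1986, (3.89) p.668, (4.4) p.670] -/
theorem strictConcaveOn_kingFreeEnergyInf (hc : 0 ≤ c) : StrictConcaveOn ℝ (Set.Ioi 0) (fun m : ℝ => kingFreeEnergyInf c m d) := by
  refine strictConcaveOn_of_deriv2_neg' (convex_Ioi 0) (fun m hm => (differentiableAt_kingFreeEnergyInf (d := d) hc hm).continuousAt.continuousWithinAt) fun m hm => ?_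
  have hm' : 0 < m := hm
  rw [Function.iterate_succ_apply, Function.iterate_one, (hasDerivAt_deriv_kingFreeEnergyInf (d := d) hc hm').deriv, neg_lt_zero]
  exact mul_pos (by positivity) (integral_inv_kingSym_sq_pos hc hm')

end Infinite

end Summit.QuantumFields.YangMills.BalabanUVNodes.N15KingModelRung.TorusSpectral

end
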